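import Summits.BirchSwinnertonDyer.BirchSwinnertonDyer.Theorems.PrintCf2RamifiedOffTYZTheoremACMAssembly
import Mathlib
import HarnessLib

/-!
# Route `PrintCf2`, crux stmt-BirchSwinnertonDyer-20509 `RamifiedOffTYZOfFacts`, THEOREM A: transversals of a stabiliser and the CM side WITHOUT a
# chosen transversal — the three arithmetic targets (T1) (T2) (T3) in their final form
# (cell `bsd-print-cf2`, LEAD cruxlead-20509 g32, line `offtyz-v7`, lineage cycle 33; fact-free, Theses-free, `def`-free)

HONEST FRAMING (`--supports stmt-BirchSwinnertonDyer-20509`; theorems only).  BSD is not proved by any of this; no class is closed by this file;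
item 23431 (C⁺) and crux 20509 stay OPEN.  `TheoremACMAssembly.orbitProd_sq_of_halfNorm_transport` (p811989) is stated with a CHOSEN transversal `T` of
the subgroup `H` acting on `s₀` by signs.  This file removes the choice: for a finite group `G` acting on `R` and `a ∈ R`,

* `exists_transversal` — every subgroup `H ≤ G` has a transversal `T : Finset G` (`∀ g, ∃! t ∈ T, t⁻¹ g ∈ H`) with `#T = H.index`;
* `prod_transversal_smul_eq_prod_orbit` — for `T` a transversal of the STABILISER of `a`, `∏_{t∈T} t • a = ∏_{x ∈ G•a} x` (the finite orbit
  `univ.image (· • a)`) and `#T = #(G•a)`;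
* ★ `orbitProd_sq_of_targets` — **THE CM SIDE OF THEOREM A FROM THE THREE ARITHMETIC TARGETS**: for fields `M ⊇ k₀` (`k₀` any subset), `R`, embeddings
  `j : M → ℂ`, `e : R → ℂ`, a finite COMMUTATIVE group `G` acting on the domain `R` by ring automorphisms, `s₀ ∈ R`, `a₀ = s₀²`, and `Q ∈ M`:
  (T1) `j Q = e(∏_{x ∈ G•a₀} x)` and `e(R^G) ⊆ j(k₀)`; (T3) `∀ g ∈ G, g^{#(G•a₀)} • s₀ = s₀`  ⟹  `Q = m²` with `m ∈ k₀`.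
  ((T2), «`#(G•a₀) = g(n)`», is only needed to phrase (T3) with the exponent `g(n) = [H_n : L_n]`.)

Reading for THEOREM A (memo `Cruxes/RamifiedOffTYZOfFacts/Lines/offtyz_v7_TheoremARoad.md` §3c; `TheoremARealisation.firstNormSquare_of_orbitProd_sq`, p812040):
`M` the realisation's field with `k₀ = M^N`, `Q = ∏_{x ∈ N•x₀} x`; `R = K_n^{(32)}`, `e` over `ι_K` (`TheoremAField`, p811823), `s₀ = e⁻¹ s(τ_n)`, `G = Gal(R/L₁)`;
(T3) is «`g^{g(n)} = Artin((±β₀² l^ε))` fixes `s₀`» — `TheoremAReciprocity` (p811633) + the genus character + the ambiguous classes of `ℚ(√−lq)`; (T1) is the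
transport «both products are the product of the conjugates of `X(τ_n)` over `ℚ(i,√l,√−q)`».  PROOFS ONLY.

References: orbit–stabiliser and transversals [folklore]; [cite: NeukirchSchmidtWingberg2008, §1.5]; tree p810950, p811989.
-/

noncomputable section

open scoped Classical

namespace Summit.BirchSwinnertonDyer.PrintCf2.TheoremATargets

open Finset MulAction Summit.BirchSwinnertonDyer.PrintCf2.HalfNormTransfer Summit.BirchSwinnertonDyer.PrintCf2.TheoremACMAssembly

/-! ## §1 Transversals exist -/

/-- **Every subgroup of a finite group has a (left) transversal** as a `Finset`: a set `T` meeting every coset `gH` in exactly one element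
(`∀ g, ∃! t ∈ T, t⁻¹ g ∈ H`), of cardinality `H.index`. [folklore] -/
theorem exists_transversal {G : Type*} [Group G] [Fintype G] (H : Subgroup G) :
    ∃ T : Finset G, (∀ g : G, ∃! t, t ∈ T ∧ t⁻¹ * g ∈ H) ∧ T.card = H.index := by
  -- representatives: `Quotient.out` of each left coset
  let T : Finset G := (Finset.univ : Finset (G ⧸ H)).image Quotient.out
  refine ⟨T, fun g => ?_, ?_⟩
  · refine ⟨Quotient.out (QuotientGroup.mk (s := H) g), ⟨Finset.mem_image.mpr ⟨_, Finset.mem_univ _, rfl⟩, ?_⟩, ?_⟩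
    · rw [← QuotientGroup.eq, QuotientGroup.out_eq']
    · rintro t ⟨ht, htg⟩
      obtain ⟨c, -, rfl⟩ := Finset.mem_image.mp ht
      have h1 : (QuotientGroup.mk (s := H) c.out : G ⧸ H) = QuotientGroup.mk g := QuotientGroup.eq.mpr htg
      rw [QuotientGroup.out_eq'] at h1
      rw [h1]
  · rw [Finset.card_image_of_injective _ (fun c₁ c₂ h => by simpa using congrArg (QuotientGroup.mk (s := H)) h),
      Finset.card_univ, Subgroup.index, Nat.card_eq_fintype_card]
    rfl

/-! ## §2 A transversal of the stabiliser enumerates the orbit -/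

/-- For `T` a transversal of the stabiliser of `a`, `t ↦ t • a` is a bijection of `T` onto the finite orbit `univ.image (· • a)`; hence
`∏_{t∈T} t • a = ∏_{x ∈ G•a} x` and `#T = #(G•a)`. [folklore] -/
theorem prod_transversal_smul_eq_prod_orbit {G R : Type*} [Group G] [Fintype G] [CommMonoid R] [MulAction G R] (a : R)
    {T : Finset G} (hT : ∀ g : G, ∃! t, t ∈ T ∧ t⁻¹ * g ∈ MulAction.stabilizer G a) :
    (∏ t ∈ T, t • a) = ∏ x ∈ (Finset.univ : Finset G).image (fun g => g • a), x ∧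
      T.card = ((Finset.univ : Finset G).image (fun g => g • a)).card := by
  -- `t ↦ t • a` is injective on `T` and onto the orbit
  have hinj : Set.InjOn (fun t : G => t • a) T := by
    intro t₁ h₁ t₂ h₂ h
    simp only at h
    have hmem : t₁⁻¹ * t₂ ∈ MulAction.stabilizer G a := by
      rw [MulAction.mem_stabilizer_iff, mul_smul, ← h, inv_smul_smul]
    obtain ⟨t, -, huniq⟩ := hT t₂
    rw [huniq t₁ ⟨h₁, hmem⟩, huniq t₂ ⟨h₂, by rw [inv_mul_cancel]; exact Subgroup.one_mem _⟩]
  have hsurj : ∀ x ∈ (Finset.univ : Finset G).image (fun g => g • a), ∃ t ∈ T, t • a = x := by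
    intro x hx
    obtain ⟨g, -, rfl⟩ := Finset.mem_image.mp hx
    obtain ⟨t, ⟨ht, htg⟩, -⟩ := hT g
    refine ⟨t, ht, ?_⟩
    rw [MulAction.mem_stabilizer_iff, mul_smul] at htg
    -- `t⁻¹ • g • a = a` ⟹ `g • a = t • a`
    have := congrArg (fun y => t • y) htg
    simpa only [smul_inv_smul] using this.symm
  have himage : T.image (fun t => t • a) = (Finset.univ : Finset G).image (fun g => g • a) := by
    ext x
    constructor
    · intro hx
      obtain ⟨t, -, rfl⟩ := Finset.mem_image.mp hx
      exact Finset.mem_image.mpr ⟨t, Finset.mem_univ _, rfl⟩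
    · intro hx
      obtain ⟨t, ht, rfl⟩ := hsurj x hx
      exact Finset.mem_image.mpr ⟨t, ht, rfl⟩
  refine ⟨?_, ?_⟩
  · rw [← himage, Finset.prod_image fun t₁ h₁ t₂ h₂ h => hinj h₁ h₂ h]
  · rw [← himage, Finset.card_image_of_injOn hinj]

/-! ## §3 The CM side of THEOREM A from the arithmetic targets -/

/-- ★ **THE CM SIDE FROM (T1) AND (T3).**  `G` finite commutative acting on the domain `R` by ring automorphisms, `s₀ ∈ R`, `a₀ = s₀ s₀`; embeddings
`j : M → ℂ`, `e : R → ℂ`; `k₀ ⊆ M`; `Q ∈ M`.  If (T1) `j Q = e(∏_{x ∈ G•a₀} x)` and `e(R^G) ⊆ j(k₀)`, and (T3) every `g^{#(G•a₀)}` fixes `s₀`, then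
`Q = m²` for some `m ∈ k₀`.  (A transversal `T` of `Stab_G(a₀)` exists, `#T = #(G•a₀)`, `Stab_G(a₀)` acts on `s₀` by signs, and
`TheoremACMAssembly.orbitProd_sq_of_halfNorm_transport` applies.) [folklore] [cite: NeukirchSchmidtWingberg2008, §1.5] -/
theorem orbitProd_sq_of_targets {M R G : Type*} [Field M] [CommRing R] [IsDomain R] [CommGroup G] [Fintype G] [MulSemiringAction G R]
    (j : M →+* ℂ) (e : R →+* ℂ) (s₀ : R) (k₀ : Set M) {Q : M}
    (hT1 : j Q = e (∏ x ∈ (Finset.univ : Finset G).image (fun g => g • (s₀ * s₀)), x))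
    (hT1' : ∀ r : R, (∀ g : G, g • r = r) → ∃ m ∈ k₀, j m = e r)
    (hT3 : ∀ g : G, (g ^ ((Finset.univ : Finset G).image (fun g => g • (s₀ * s₀))).card) • s₀ = s₀) :
    ∃ m ∈ k₀, Q = m ^ 2 := by
  obtain ⟨T, hT, -⟩ := exists_transversal (MulAction.stabilizer G (s₀ * s₀))
  obtain ⟨hprod, hcard⟩ := prod_transversal_smul_eq_prod_orbit (s₀ * s₀) hT
  have hH : ∀ h ∈ MulAction.stabilizer G (s₀ * s₀), h • s₀ = s₀ ∨ h • s₀ = -s₀ :=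
    fun h hh => smul_eq_self_or_neg_of_smul_sq_eq (MulAction.mem_stabilizer_iff.mp hh)
  refine orbitProd_sq_of_halfNorm_transport j e hH hT (fun g => ?_) k₀ hT1' (by rw [hprod]; exact hT1)
  rw [hcard]; exact hT3 g

end Summit.BirchSwinnertonDyer.PrintCf2.TheoremATargets

end
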